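import Mathlib
import Summits.NavierStokesRegularity.NavierStokesRegularity.Theorems.TypeIQuarterGateQuarterZoomTypeIClock
import HarnessLib

/-!
# `TypeIQuarterGate`: the Type-I clock of the quarter zoom — PER-SOLUTION form with the explicit
# clock constant (the blow-up's own dimensionless Type-I constant)

Helper file for crux `QuarterLawTypeI` (stmt-NavierStokesRegularity-23726), companion of
`TypeIQuarterGateQuarterZoomTypeIClock` (theorems only, no definitions). The landed
`typeIQuarterGate_quarterZoom_typeIClock` is stated under the GLOBAL hypotheses `NoTypeII` and
`QuarterLawTypeI` and hides the clock constant behind `∃ C'`. Here the same zoom is run for ONE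
solution: a classical Leray–Hopf solution on `[0,T)` from a rapidly decaying datum, with no smooth
extension past `T`, velocity-Type-I with constant `C_I` near `T` and obeying the quarter law
`∫|curl u(t)|² ≤ K/√(T−t)` on `[0,T)`, generates a NONTRIVIAL bounded ancient mild solution (`ν = 1`),
smooth, with slice enstrophy `≤ 1`, `L⁶` slices and the Type-I clock
`√(−s)‖v(s,y)‖ ≤ max C_I 0 / √ν` — the clock constant of the limit is the blow-up's dimensionless
Type-I constant (KNSS 2009 §6: Type-I blow-up generates a Type-I ancient mild solution; here inside
Galdi's parabolic class thanks to the quarter law).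

* `QuarterZoomTypeIClock.quarterZoom_typeIClock_of_rate` — the per-solution statement above.

HONEST FRAMING: a statement about a HYPOTHETICAL blow-up; nothing here bears on Navier–Stokes
regularity. References: Koch–Nadirashvili–Seregin–Šverák, Acta Math. 203 (2009), §6; Leray 1934 §20.
-/

noncomputable section

set_option linter.dupNamespace false

namespace Summit.NavierStokesRegularity.NavierStokesRegularity.Theorems

open Set MeasureTheory Filter Topology Function
open scoped ENNReal NNReal
open Literature.Analysis.FluidPDE
open RecordZoomAncient.Birth

namespace QuarterZoomTypeIClock

/-- **Per-solution Type-I clock of the quarter zoom, explicit constant.** A classical Leray–Hopf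
solution on `[0,T)` from a rapidly decaying datum with no smooth extension past `T`, velocity-Type-I
near `T` with constant `C_I` (`‖u(t,x)‖ ≤ C_I/√(T−t)` eventually as `t ↑ T`) and obeying the quarter law
`∫|curl u(t)|² ≤ K/√(T−t)` on `[0,T)`, has a zoom limit `v`: a NONTRIVIAL bounded ancient mild solution
(`ν = 1`), smooth on `(−∞,0) × ℝ³`, slice enstrophy `≤ 1`, `L⁶` slices, with
`√(−s)‖v(s,y)‖ ≤ max C_I 0/√ν` for all `s < 0`, `y`.
[cite: KochNadirashviliSereginSverak2009, §6 (Type-I zoom limits)] [cite: Leray1934, §20] -/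
theorem quarterZoom_typeIClock_of_rate
    (ν T : ℝ) (hν : 0 < ν) (hT : 0 < T)
    (u : ℝ → EuclideanSpace ℝ (Fin 3) → EuclideanSpace ℝ (Fin 3))
    (p : ℝ → EuclideanSpace ℝ (Fin 3) → ℝ)
    (hcl : IsClassicalNSSolutionOn (Set.Ico 0 T) ν 0 u p) (hLH : IsLerayHopfOn T ν 0 (u 0) u)
    (hdec : HasRapidSpatialDecay (u 0)) (hnext : ¬ HasSmoothExtensionPast ν 0 u T)
    (CI : ℝ) (hCI : ∀ᶠ t in 𝓝[<] T, ∀ x, ‖u t x‖ ≤ CI / Real.sqrt (T - t))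
    (K : ℝ) (hK : ∀ t ∈ Set.Ico 0 T,
      ∫⁻ x, ‖curl (u t) x‖ₑ ^ 2 ≤ ENNReal.ofReal (K / Real.sqrt (T - t))) :
    ∃ v : ℝ → EuclideanSpace ℝ (Fin 3) → EuclideanSpace ℝ (Fin 3),
      IsBoundedAncientMildSolution 1 v ∧
      ContDiffOn ℝ (⊤ : ℕ∞) (Function.uncurry v) (Set.Iio 0 ×ˢ Set.univ) ∧
      (∀ s < 0, ∫⁻ y, ENNReal.ofReal (frobeniusNormSq (fderiv ℝ (v s) y)) ≤ 1) ∧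
      (∀ s < 0, MemLp (v s) 6 volume) ∧ ¬ (∀ s < 0, ∀ y, v s y = 0) ∧
      ∀ s < 0, ∀ y, Real.sqrt (-s) * ‖v s y‖ ≤ max CI 0 / Real.sqrt ν := by
  have hrep : ∀ T' ∈ Set.Ioo 0 T, ∃ P : ℝ → EuclideanSpace ℝ (Fin 3) → ℝ,
      IsTaoSolutionOn T' ν (u 0) u P :=
    stub_taoRep ν T hν hT u p hcl hLH hdec
  obtain ⟨cP, KP, hcP, hKP, hpers⟩ := stub_enstrophyPersistence
  have hpers' := hpers ν T hν hT u p hcl hrep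
  obtain ⟨cL, hcL, hLer⟩ := leray_blowup_rate_top_holds
  have hstrip : ∀ T' ∈ Set.Ioo 0 T,
      eLpNorm (uncurry u) ∞ (volume.restrict (Set.Icc 0 T' ×ˢ univ)) < ∞ := by
    intro T' hT'
    obtain ⟨P, hP⟩ := hrep T' hT'
    obtain ⟨B, -, hB⟩ := hP.exists_bound_velocity
    rw [eLpNorm_exponent_top]
    refine eLpNormEssSup_lt_top_of_ae_bound (C := B) ?_
    filter_upwards [ae_restrict_mem (measurableSet_Icc.prod MeasurableSet.univ)] with w hw
    obtain ⟨t, x⟩ := w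
    exact hB t hw.1 x
  have hrate : ∀ t ∈ Set.Ico 0 T, ∃ x, cL / 2 * Real.sqrt ν / Real.sqrt (T - t) ≤ ‖u t x‖ := by
    intro t ht
    have h := hLer ν T hν hT u p ⟨hcl, hnext⟩ hLH hstrip t ht
    have ha : 0 < cL * Real.sqrt ν / Real.sqrt (T - t) := by
      have h1 : 0 < Real.sqrt ν := Real.sqrt_pos.2 hν
      have h2 : 0 < Real.sqrt (T - t) := Real.sqrt_pos.2 (sub_pos.2 ht.2)
      positivity
    obtain ⟨x, hx⟩ := exists_half_le_norm_of_ofReal_le_eLpNorm_top ha h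
    refine ⟨x, ?_⟩
    have heq : cL / 2 * Real.sqrt ν / Real.sqrt (T - t) =
        cL * Real.sqrt ν / Real.sqrt (T - t) / 2 := by ring
    rw [heq]
    exact hx
  -- (2) the quarter law in Frobenius form: Type-I enstrophy at EVERY time
  set K' : ℝ := max K 1 with hK'
  have hK'0 : 0 < K' := lt_of_lt_of_le one_pos (le_max_right _ _)
  have hsν : 0 < ν * Real.sqrt ν := mul_pos hν (Real.sqrt_pos.2 hν)
  set C : ℝ := K' / (ν * Real.sqrt ν) with hC
  have hC0 : 0 < C := div_pos hK'0 hsν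
  have hCid : ∀ t, C * (ν * Real.sqrt ν) / Real.sqrt (T - t) = K' / Real.sqrt (T - t) := by
    intro t
    rw [hC, div_mul_cancel₀ _ hsν.ne']
  have hfrob : ∀ s ∈ Set.Ico 0 T,
      (∫⁻ x, ENNReal.ofReal (frobeniusNormSq (fderiv ℝ (u s) x))) ≤
        ENNReal.ofReal (K / Real.sqrt (T - s)) := by
    intro s hs
    have hs2 : ContDiff ℝ 2 (u s) := (hcl.contDiff_velocity hs).of_le (by norm_cast)
    have hL2 : ∫⁻ x, ‖u s x‖ₑ ^ 2 < ⊤ := by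
      have hm : MemLp (u s) 2 volume := hLH.memLp s ⟨hs.1, hs.2.le⟩
      have h := lintegral_rpow_enorm_lt_top_of_eLpNorm_lt_top two_ne_zero ENNReal.ofNat_ne_top
        hm.eLpNorm_lt_top
      simpa [ENNReal.toReal_ofNat] using h
    exact (lintegral_frobeniusNormSq_fderiv_le_lintegral_sq_norm_curl hs2 (hcl.divFree s hs)
      hL2).trans (hK s hs)
  have hIII : ∀ t' ∈ Set.Ico 0 T, ∃ t ∈ Set.Ico t' T, ∀ s ∈ Set.Icc 0 t,
      (∫⁻ x, ENNReal.ofReal (frobeniusNormSq (fderiv ℝ (u s) x))) ≤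
        ENNReal.ofReal (C * (ν * Real.sqrt ν) / Real.sqrt (T - t)) := by
    intro t' ht'
    refine ⟨t', ⟨le_rfl, ht'.2⟩, fun s hs => ?_⟩
    have hsT : s ∈ Set.Ico 0 T := ⟨hs.1, hs.2.trans_lt ht'.2⟩
    refine (hfrob s hsT).trans (ENNReal.ofReal_le_ofReal ?_)
    rw [hCid]
    have h1 : 0 < Real.sqrt (T - t') := Real.sqrt_pos.2 (sub_pos.2 ht'.2)
    have h2 : Real.sqrt (T - t') ≤ Real.sqrt (T - s) := Real.sqrt_le_sqrt (by linarith [hs.2])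
    calc K / Real.sqrt (T - s) ≤ K' / Real.sqrt (T - s) :=
          div_le_div_of_nonneg_right (le_max_left _ _) (h1.le.trans h2)
      _ ≤ K' / Real.sqrt (T - t') := div_le_div_of_nonneg_left hK'0.le h1 h2
  -- (3) the Type-I-enstrophy branch: velocity-concentrated enstrophy-normalised zooms
  obtain ⟨tc, xc, L, s₀, θ, hs₀, hθ, htc, hL, hdom, hpast, hconc⟩ :=
    stub_typeIBranch ν T hν hT u p hcl (cL / 2) (by positivity) hrate cP KP hcP hKP hpers' C hC0 hIII
  -- (4) a global velocity bound `B + C_I/√(T−t)` on `[0, T)` from the eventual Type-I rate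
  obtain ⟨T₁, hT₁T, hIsub⟩ := mem_nhdsLT_iff_exists_Ioo_subset.1 hCI
  set T' : ℝ := max T₁ (T / 2) with hT'
  have hT'mem : T' ∈ Set.Ioo 0 T :=
    ⟨lt_of_lt_of_le (half_pos hT) (le_max_right _ _), max_lt hT₁T (half_lt_self hT)⟩
  obtain ⟨P, hP⟩ := hrep T' hT'mem
  obtain ⟨B, hB0, hB⟩ := hP.exists_bound_velocity
  set CI' : ℝ := max CI 0 with hCI'
  have hCI'0 : 0 ≤ CI' := le_max_right _ _
  have hglob : ∀ t ∈ Set.Ico 0 T, ∀ x, ‖u t x‖ ≤ B + CI' / Real.sqrt (T - t) := by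
    intro t ht x
    have hst : 0 < Real.sqrt (T - t) := Real.sqrt_pos.2 (sub_pos.2 ht.2)
    have hnn : 0 ≤ CI' / Real.sqrt (T - t) := div_nonneg hCI'0 hst.le
    by_cases htT' : t ≤ T'
    · exact (hB t ⟨ht.1, htT'⟩ x).trans (le_add_of_nonneg_right hnn)
    · have htmem : t ∈ Set.Ioo T₁ T := ⟨lt_of_le_of_lt (le_max_left _ _) (not_le.1 htT'), ht.2⟩
      have h1 : ‖u t x‖ ≤ CI / Real.sqrt (T - t) := hIsub htmem x
      have h2 : CI / Real.sqrt (T - t) ≤ CI' / Real.sqrt (T - t) :=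
        div_le_div_of_nonneg_right (le_max_left _ _) hst.le
      exact (h1.trans h2).trans (le_add_of_nonneg_left hB0)
  -- (5) the common tail, re-run: universal bound after one critical unit, zooms, KNSS limit
  obtain ⟨Cz, hCz⟩ := stub_zoomBound
  have hbd : ∀ n, ∀ t ∈ Set.Icc (ν ^ 3 / L n ^ 2) (tc n), ∀ x, ‖u t x‖ ≤ Cz * L n / ν :=
    fun n t ht x => hCz ν T hν hT u p hcl hLH hdec hrep (tc n) (L n) (htc n).1 (htc n).2 (hL n)
      (hdom n) t ht x
  set z : ℕ → ℝ → EuclideanSpace ℝ (Fin 3) → EuclideanSpace ℝ (Fin 3) :=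
    fun n s y => (ν / L n) • u (tc n + ν ^ 3 / L n ^ 2 * s) (xc n + (ν ^ 2 / L n) • y) with hz_def
  have hz : ∀ n s y, z n s y =
      (ν / L n) • u (tc n + ν ^ 3 / L n ^ 2 * s) (xc n + (ν ^ 2 / L n) • y) := fun n s y => rfl
  obtain ⟨φ, v, hφ, hconv, hmild, hsmooth, hens, hL6⟩ :=
    stub_zoomLimit ν T hν hT u p hcl hLH hdec hrep tc xc L htc hL hdom hpast Cz hbd z hz
  refine ⟨v, hmild, hsmooth, hens, hL6, ?_, ?_⟩
  · -- non-triviality, read off at the rescaled time `s₀` and the origin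
    intro hzero
    have hslice0 : v s₀ 0 = 0 := hzero _ hs₀ 0
    have hlim : Tendsto (fun n => ‖z (φ n) s₀ 0‖) atTop (𝓝 0) := by
      have h := (hconv _ hs₀ 0).norm
      rwa [hslice0, norm_zero] at h
    have hlow : ∀ n, θ ≤ ‖z (φ n) s₀ 0‖ := fun n => by
      have h := hconc (φ n)
      simpa only [hz, smul_zero, add_zero] using h
    have hθle : θ ≤ 0 := ge_of_tendsto' hlim hlow
    linarith
  · -- the Type-I clock passes to the pointwise limit
    intro s hs y
    have hLtop : Tendsto L atTop atTop := tendsto_level_atTop hT htc hL hpast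
    have hLφ : Tendsto (fun n => L (φ n)) atTop atTop := hLtop.comp hφ.tendsto_atTop
    have hpastφ : Tendsto (fun n => tc (φ n) * L (φ n) ^ 2) atTop atTop :=
      hpast.comp hφ.tendsto_atTop
    have hzb : ∀ᶠ n in atTop, Real.sqrt (-s) * ‖z (φ n) s y‖ ≤
        Real.sqrt (-s) * (ν * B / L (φ n)) + CI' / Real.sqrt ν := by
      filter_upwards [hpastφ.eventually_ge_atTop (ν ^ 3 * (-s))] with n hn
      rw [hz]
      exact zoom_clock_bound hν hCI'0 (htc (φ n)).2 (hL (φ n)) hs hn hglob _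
    have ha : Tendsto (fun n => Real.sqrt (-s) * ‖z (φ n) s y‖) atTop
        (𝓝 (Real.sqrt (-s) * ‖v s y‖)) :=
      ((hconv s hs y).norm).const_mul _
    have hb : Tendsto (fun n => Real.sqrt (-s) * (ν * B / L (φ n)) + CI' / Real.sqrt ν) atTop
        (𝓝 (Real.sqrt (-s) * 0 + CI' / Real.sqrt ν)) :=
      ((tendsto_const_nhds.div_atTop hLφ).const_mul _).add tendsto_const_nhds
    rw [mul_zero, zero_add] at hb
    exact le_of_tendsto_of_tendsto ha hb hzb

end QuarterZoomTypeIClock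

end Summit.NavierStokesRegularity.NavierStokesRegularity.Theorems

end
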